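import Summits.ResolutionOfSingularities.ResolutionOfSingularities.Theorems.ValuativeTorsorToLurelSandwichLower
import Summits.ResolutionOfSingularities.ResolutionOfSingularities.Theorems.ValuativeTorsorToLurelSepLayer
import Summits.ResolutionOfSingularities.ResolutionOfSingularities.Theorems.ValuativeTorsorToLurelValuationUp

/-!
# `Valuative.TorsorToLurel`: the perfect-closure sandwich (`stub_ttlPerfectDescent`)

Route `ResolutionOfSingularities/Valuative`, crux `TorsorToLurel`
(stmt-ResolutionOfSingularities-10968), line `Sketch` (perfect-closure descent: the crux for
EVERY ground field `k` of characteristic `p` from its `F`-finite special case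
`TorsorToLurelFfinite` run over the PERFECT closure of `k`). This file proves the lead's
registered stub `stub_ttlPerfectDescent`:

> local uniformization (relative form) over perfect ground fields of characteristic `p` yields,
> for every ground field `k` of characteristic `p`, every finitely generated `K/k`, every
> valuation ring `O ⊇ k` of `K` and every finitely generated `R ⊆ O`, a finitely generated
> `k`-subalgebra `A₀ ⊆ O`, REGULAR at the centre `𝔪_O ∩ A₀`, and one exponent `m` with
> `R ^ {p^m} ⊆ A₀` and `K ^ {p^m} ⊆ k(A₀)`.

(The torsor hypothesis of the crux then climbs the finite purely inseparable extension
`k(A₀) ⊆ K` and absorbs `R` — stub `stub_ttlTowerAbsorb`, landed separately.)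

## Proof (the sandwich)

Inside `Ω = K^alg` let `k' = k^{perf}` (perfect closure of `k` in `Ω`; perfect, purely
inseparable over `k`) and `K' = k'(K)` (purely inseparable over `K`, finitely generated over
`k'`); the valuation ring `O` extends to `O'` on `K'` (`stub_ttlValuationUp`). Local
uniformization over the perfect field `k'` gives a chart `A' = k'[S_A] ⊇ k'[R]` of `O'`, regular at
the centre, `Frac A' = K'`. Each `a ∈ S_A` has `a^{p^N} = ι(y_a)`, `y_a ∈ K`; with `e` the exponent
of the separable Frobenius layer of `K/k` (`stub_ttlSepLayer`: `K^{p^e}` is separable over a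
purely transcendental `k(x)`), put `M = N + e` and `B = k[y_a^{p^e}] ⊆ K`. Then
(`stub_ttlSandwichLower`): Frobenius `F^M` maps `A'` isomorphically onto `T = k'[ι B]`, regular at
the centre of `O'`; `B ⊗ₖ k' → K'` is INJECTIVE with image `T` (Mac Lane: the separable layer is
linearly disjoint from the purely inseparable `k'`), so `B` is regular at the centre of
`O' ∩ K = O` by faithfully flat descent (Matsumura 23.7 (i)); and one exponent `m` gives
`R^{p^m} ⊆ B`, `K^{p^m} ⊆ k(B)`.

References: Temkin, *Inseparable local uniformization*, J. Algebra 373 (2013), Rem. 1.3.5;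
Matsumura, *Commutative Ring Theory*, Thm. 23.7 (i), Thm. 26.4 (Mac Lane); the barrier
`Literature.Barriers.ResolutionOfSingularities.InseparableBaseChange` is evaded by direction
(regularity is DESCENDED along a flat base change, never ascended along an inseparable one).
-/

noncomputable section

set_option linter.dupNamespace false -- mandated namespace of this single-conjunct summit

open IsLocalRing
open scoped TensorProduct

namespace Summit.ResolutionOfSingularities.ResolutionOfSingularities.Theorems

/-- **The perfect-closure sandwich, predicate-restricted form.** As `stub_ttlPerfectDescent`,
but local uniformization over perfect ground fields is only assumed for valued function fields
satisfying a predicate `Q` that is inherited by the base change `(k, K, O) ↦ (k', k'K, O')` to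
an algebraic extension `k'/k` of the constants (`k'K/K` purely inseparable, `O' ∩ K = O`); e.g.
`Q = ⊤` (the stub itself) or `Q = ` "transcendence defect `0`" (Abhyankar valuations). -/
theorem ttl_perfectDescent_of_pred (p : ℕ) [Fact p.Prime]
    (Q : ∀ (k K : Type) [Field k] [Field K] [Algebra k K] (O : ValuationSubring K),
      (∀ c : k, algebraMap k K c ∈ O) → Prop)
    (hQ : ∀ (k K k' K' : Type) [Field k] [Field K] [Field k'] [Field K'] [Algebra k K]
      [Algebra k k'] [Algebra k' K'] [Algebra k K'] [Algebra K K'] [IsScalarTower k k' K']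
      [IsScalarTower k K K'] [Algebra.IsAlgebraic k k'] [IsPurelyInseparable K K']
      (O' : ValuationSubring K') (hk : ∀ c : k, algebraMap k K c ∈ O'.comap (algebraMap K K'))
      (hk' : ∀ c : k', algebraMap k' K' c ∈ O'),
      (⊤ : IntermediateField k K).FG → Q k K (O'.comap (algebraMap K K')) hk → Q k' K' O' hk')
    (hLU : ∀ (k K : Type) [Field k] [CharP k p] [PerfectField k] [Field K] [Algebra k K],
      (⊤ : IntermediateField k K).FG → ∀ (O : ValuationSubring K)
      (hk : ∀ c : k, algebraMap k K c ∈ O), Q k K O hk →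
      ∀ R : Subalgebra k K, R.FG → R.toSubring ≤ O.toSubring →
      ∃ (A : Subalgebra k K) (h : A.toSubring ≤ O.toSubring), R ≤ A ∧ A.FG ∧ IsFractionRing A K ∧
        IsRegularLocalRing (Localization.AtPrime
          (Ideal.comap (Subring.inclusion h) (maximalIdeal O))))
    (k K : Type) [Field k] [CharP k p] [Field K] [Algebra k K] (hfg : (⊤ : IntermediateField k K).FG)
    (O : ValuationSubring K) (hO : ∀ c : k, algebraMap k K c ∈ O) (hq : Q k K O hO)
    (R : Subalgebra k K) (hRfg : R.FG) (hRO : R.toSubring ≤ O.toSubring) :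
    ∃ (m : ℕ) (A₀ : Subalgebra k K) (h₀ : A₀.toSubring ≤ O.toSubring), A₀.FG ∧
      (∀ r ∈ R, r ^ p ^ m ∈ A₀) ∧
      (∀ x : K, x ^ p ^ m ∈ IntermediateField.adjoin k (A₀ : Set K)) ∧
      IsRegularLocalRing (Localization.AtPrime
        (Ideal.comap (Subring.inclusion h₀) (maximalIdeal O))) := by
  classical
  have hp : p.Prime := Fact.out
  haveI : CharP K p := (Algebra.charP_iff k K p).mp inferInstance
  haveI : ExpChar k p := ExpChar.prime hp
  haveI : ExpChar K p := ExpChar.prime hp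
  -- ===== Step A: the ambient perfect field and the perfect closure of `k` =====
  let Ω : Type := AlgebraicClosure K
  -- cache the instance paths of the ambient field (elaboration speed)
  letI instFΩ : Field Ω := inferInstance
  letI instAkΩ : Algebra k Ω := inferInstance
  letI instAKΩ : Algebra K Ω := inferInstance
  haveI instTΩ : IsScalarTower k K Ω := inferInstance
  let ιK : K →ₐ[k] Ω := IsScalarTower.toAlgHom k K Ω
  have hιK : ∀ z : K, ιK z = algebraMap K Ω z := fun _ => rfl
  haveI : CharP Ω p := (Algebra.charP_iff K Ω p).mp inferInstance
  haveI : ExpChar Ω p := ExpChar.prime hp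
  let k'f : IntermediateField k Ω := perfectClosure k Ω
  let k' : Type := k'f
  letI instFk' : Field k' := inferInstance
  letI instAkk' : Algebra k k' := inferInstance
  letI instMkk' : Module k k' := inferInstance
  letI instAk'Ω : Algebra k' Ω := inferInstance
  haveI instTk'Ω : IsScalarTower k k' Ω := inferInstance
  haveI : PerfectField k' := perfectClosure.perfectField k Ω
  haveI : CharP k' p := (Algebra.charP_iff k k' p).mp inferInstance
  haveI : ExpChar k' p := ExpChar.prime hp
  haveI : IsPurelyInseparable k k' := perfectClosure.isPurelyInseparable k Ω
  -- field generators of `K/k`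
  obtain ⟨TK, hTK⟩ := hfg
  -- ===== Step B: the compositum `K' = k'(ι T) ⊆ Ω` =====
  let K'f : IntermediateField k' Ω := IntermediateField.adjoin k' (ιK '' (TK : Set K))
  let K' : Type := K'f
  letI instFK' : Field K' := inferInstance
  letI instAk'K' : Algebra k' K' := inferInstance
  letI instAkK' : Algebra k K' := inferInstance
  letI instMk'K' : Module k' K' := inferInstance
  letI instMkK' : Module k K' := inferInstance
  haveI instTK' : IsScalarTower k k' K' := inferInstance
  haveI : CharP K' p := (Algebra.charP_iff k K' p).mp inferInstance
  -- `ι(K) ⊆ K'`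
  have hrangeK' : ∀ z : K, ιK z ∈ K'f := by
    intro z
    have hz : z ∈ (⊤ : IntermediateField k K) := IntermediateField.mem_top
    rw [← hTK] at hz
    have hz' : ιK z ∈ (IntermediateField.adjoin k (TK : Set K)).map ιK := ⟨z, hz, rfl⟩
    rw [IntermediateField.adjoin_map] at hz'
    have hle : IntermediateField.adjoin k (ιK '' (TK : Set K)) ≤ K'f.restrictScalars k :=
      IntermediateField.adjoin_le_iff.mpr (IntermediateField.subset_adjoin k' _)
    exact hle hz'
  -- the embedding `ι' : K → K'`
  let ι' : K →ₐ[k] K' :=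
    { toFun := fun z => ⟨ιK z, hrangeK' z⟩
      map_one' := Subtype.ext (map_one ιK)
      map_mul' := fun a b => Subtype.ext (map_mul ιK a b)
      map_zero' := Subtype.ext (map_zero ιK)
      map_add' := fun a b => Subtype.ext (map_add ιK a b)
      commutes' := fun c => Subtype.ext (by
        change ιK (algebraMap k K c) = algebraMap k Ω c
        rw [AlgHom.commutes]) }
  have hι' : ∀ z : K, ((ι' z : K') : Ω) = ιK z := fun _ => rfl
  have hι'inj : Function.Injective ι' := fun a b h => by
    have := congrArg (fun w : K' => (w : Ω)) h
    exact ιK.injective this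
  letI : Algebra K K' := (ι' : K →+* K').toAlgebra
  have halgKK' : ∀ z : K, algebraMap K K' z = ι' z := fun _ => rfl
  haveI : IsScalarTower k K K' := IsScalarTower.of_algebraMap_eq fun c => (ι'.commutes c).symm
  haveI : Algebra.IsAlgebraic k k' := perfectClosure.isAlgebraic k Ω
  -- the embedding `jK' : K' → Ω`
  let jK' : K' →ₐ[k] Ω := (K'f.val).restrictScalars k
  have hjK' : ∀ w : K', jK' w = (w : Ω) := fun _ => rfl
  have hjinj : Function.Injective jK' := fun a b h => Subtype.ext h
  have hjg : ∀ c : k', jK' (algebraMap k' K' c) = algebraMap k' Ω c := fun _ => rfl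
  -- `K'/K` is purely inseparable
  haveI hpiKK' : IsPurelyInseparable K K' := by
    rw [isPurelyInseparable_iff_pow_mem K p]
    intro z
    -- `K' ⊆ perfectClosure K Ω`
    have hsub : (z : Ω) ∈ perfectClosure K Ω := by
      let PC : IntermediateField k' Ω :=
        (perfectClosure K Ω).toSubfield.toIntermediateField (fun c => by
          change (c : Ω) ∈ perfectClosure K Ω
          obtain ⟨n, d, hd⟩ := (mem_perfectClosure_iff_pow_mem p).mp c.2
          exact (mem_perfectClosure_iff_pow_mem p).mpr ⟨n, algebraMap k K d, by
            rw [← hd, IsScalarTower.algebraMap_apply k K Ω]⟩)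
      have hle : K'f ≤ PC := by
        refine IntermediateField.adjoin_le_iff.mpr ?_
        rintro _ ⟨t, -, rfl⟩
        change ιK t ∈ perfectClosure K Ω
        exact (mem_perfectClosure_iff_pow_mem p).mpr ⟨0, t, by rw [pow_zero, pow_one]; rfl⟩
      exact hle z.2
    obtain ⟨n, y, hy⟩ := (mem_perfectClosure_iff_pow_mem p).mp hsub
    refine ⟨n, y, Subtype.ext ?_⟩
    rw [halgKK']
    change ιK y = ((z ^ p ^ n : K') : Ω)
    rw [hιK, hy]
    rfl
  -- ===== Step C: the valuation ring `O'` of `K'` over `O` =====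
  obtain ⟨O', hO'⟩ := stub_ttlValuationUp K K' O
  subst hO'
  have hpM0 : ∀ n : ℕ, p ^ n ≠ 0 := fun n => pow_ne_zero n hp.ne_zero
  -- constants of `k'` lie in `O'`
  have hk'O' : ∀ c : k', algebraMap k' K' c ∈ O' := by
    intro c
    obtain ⟨n, d, hd⟩ := (mem_perfectClosure_iff_pow_mem p).mp c.2
    rw [← valuationSubring_pow_mem_iff O' (hpM0 n)]
    have hcd : (algebraMap k' K' c) ^ p ^ n = ι' (algebraMap k K d) := by
      apply Subtype.ext
      change ((algebraMap k' K' c : K') : Ω) ^ p ^ n = ιK (algebraMap k K d)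
      rw [AlgHom.commutes, hd]
      rfl
    rw [hcd]
    exact hO d
  -- ===== Step D: local uniformization over the perfect field `k'` =====
  have hfg' : (⊤ : IntermediateField k' K').FG := by
    refine ⟨TK.image ι', ?_⟩
    apply IntermediateField.lift_injective K'f
    rw [IntermediateField.lift_adjoin, IntermediateField.lift_top, Finset.coe_image,
      Set.image_image]
    rfl
  obtain ⟨SR, hSR⟩ := hRfg
  let Oalg' : Subalgebra k' K' := { O'.toSubring with algebraMap_mem' := hk'O' }
  let R' : Subalgebra k' K' := Algebra.adjoin k' ((SR.image ι' : Finset K') : Set K')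
  have hRO' : ∀ r ∈ R, ι' r ∈ O' := fun r hr => hRO hr
  have hR'O' : R'.toSubring ≤ O'.toSubring := by
    have hle : R' ≤ Oalg' := Algebra.adjoin_le (by
      rw [Finset.coe_image]
      rintro _ ⟨r, hr, rfl⟩
      exact hRO' r (hSR ▸ Algebra.subset_adjoin hr))
    exact fun x hx => hle hx
  obtain ⟨A', hA'O', hR'A', hA'fg, hA'fr, hA'reg⟩ :=
    hLU k' K' hfg' O' hk'O' (hQ k K k' K' O' hO hk'O' ⟨TK, hTK⟩ hq) R' ⟨_, rfl⟩ hR'O'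
  have hRA' : ∀ r ∈ SR, ι' r ∈ A' := fun r hr =>
    hR'A' (Algebra.subset_adjoin (by rw [Finset.coe_image]; exact ⟨r, hr, rfl⟩))
  -- ===== Step E: generators of `A'` and a uniform `p`-radicality exponent `N` =====
  obtain ⟨SA, hSA⟩ := hA'fg
  have hrad : ∀ a : K', ∃ n : ℕ, ∀ n', n ≤ n' → ∃ y : K, ι' y = a ^ p ^ n' := by
    intro a
    obtain ⟨n, y, hy⟩ := IsPurelyInseparable.pow_mem K p a
    refine ⟨n, fun n' hn' => ⟨y ^ p ^ (n' - n), ?_⟩⟩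
    rw [map_pow, ← halgKK', hy, ← pow_mul, ← pow_add, Nat.add_sub_cancel' hn']
  choose nr hnr using hrad
  obtain ⟨N, hN⟩ : ∃ N : ℕ, ∀ a ∈ SA, ∃ y : K, ι' y = a ^ p ^ N :=
    ⟨SA.sup nr, fun a ha => hnr a _ (Finset.le_sup ha)⟩
  choose! yA hyA using hN
  -- ===== Step F: the separable Frobenius layer (Mac Lane) =====
  obtain ⟨n, x, e, hx, hsep⟩ := stub_ttlSepLayer p k K ⟨TK, hTK⟩ Ω
  obtain ⟨M, hM⟩ : ∃ M : ℕ, M = N + e := ⟨_, rfl⟩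
  have hιB : ∀ a ∈ SA, ι' (yA a ^ p ^ e) = a ^ p ^ M := fun a ha => by
    rw [map_pow, hyA a ha, ← pow_mul, ← pow_add, ← hM]
  let E₀ : IntermediateField k Ω :=
    IntermediateField.adjoin k (Set.range fun i => algebraMap K Ω (x i))
  let 𝔽 : IntermediateField k Ω := (separableClosure E₀ Ω).restrictScalars k
  have hx𝔽 : ∀ i, algebraMap K Ω (x i) ∈ 𝔽 := fun i => by
    change algebraMap K Ω (x i) ∈ separableClosure E₀ Ω
    have hmem : algebraMap K Ω (x i) ∈ E₀ := IntermediateField.subset_adjoin k _ ⟨i, rfl⟩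
    exact (separableClosure E₀ Ω).algebraMap_mem ⟨_, hmem⟩
  have hsep𝔽 : ∀ y ∈ 𝔽, IsSeparable E₀ y := fun y hy => (mem_separableClosure_iff.mp hy)
  have HLD : 𝔽.LinearDisjoint k' :=
    Literature.AlgebraicGeometry.Resolution.linearDisjoint_of_isPurelyInseparable_of_isSeparable
      k' hx 𝔽 hx𝔽 hsep𝔽
  have hB𝔽 : ∀ a ∈ SA, jK' (ι' (yA a ^ p ^ e)) ∈ 𝔽 := fun a _ =>
    mem_separableClosure_iff.mpr (hsep (yA a))
  -- ===== Steps G–K: the sandwich below the perfect closure =====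
  obtain ⟨m, B, h₀B, hBfg, hRpow', hKpow, hregB⟩ :=
    stub_ttlSandwichLower p k K K' k' Ω jK' hjinj hjg 𝔽 HLD ι' hι'inj O' A' hA'O' hA'fr hA'reg SA hSA
      SR hRA' TK hTK yA e M hιB hB𝔽
  have hRpow : ∀ r ∈ R, r ^ p ^ m ∈ B := fun r hr => hRpow' r (hSR.symm ▸ hr)
  -- ===== Output (rephrase the valuation ring as `O'.comap (algebraMap K K')`) =====
  have hOι : O'.comap (ι' : K →+* K') = O'.comap (algebraMap K K') := rfl
  have h₀B' : B.toSubring ≤ (O'.comap (algebraMap K K')).toSubring := h₀B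
  have hregB' := ttl_isRegularLocalRing_centre_congr hOι h₀B h₀B' hregB
  exact ⟨m, B, h₀B', hBfg, hRpow, hKpow, hregB'⟩

/-- The perfect-closure sandwich (statement = registered stub `stub_ttlPerfectDescent`):
`ttl_perfectDescent_of_pred` with the trivial predicate. -/
theorem stub_ttlPerfectDescent (p : ℕ) [Fact p.Prime]
    (hLU : ∀ (k K : Type) [Field k] [CharP k p] [PerfectField k] [Field K] [Algebra k K],
      (⊤ : IntermediateField k K).FG → ∀ O : ValuationSubring K, (∀ c : k, algebraMap k K c ∈ O) →
      ∀ R : Subalgebra k K, R.FG → R.toSubring ≤ O.toSubring →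
      ∃ (A : Subalgebra k K) (h : A.toSubring ≤ O.toSubring), R ≤ A ∧ A.FG ∧ IsFractionRing A K ∧
        IsRegularLocalRing (Localization.AtPrime
          (Ideal.comap (Subring.inclusion h) (maximalIdeal O))))
    (k K : Type) [Field k] [CharP k p] [Field K] [Algebra k K] (hfg : (⊤ : IntermediateField k K).FG)
    (O : ValuationSubring K) (hO : ∀ c : k, algebraMap k K c ∈ O)
    (R : Subalgebra k K) (hRfg : R.FG) (hRO : R.toSubring ≤ O.toSubring) :
    ∃ (m : ℕ) (A₀ : Subalgebra k K) (h₀ : A₀.toSubring ≤ O.toSubring), A₀.FG ∧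
      (∀ r ∈ R, r ^ p ^ m ∈ A₀) ∧
      (∀ x : K, x ^ p ^ m ∈ IntermediateField.adjoin k (A₀ : Set K)) ∧
      IsRegularLocalRing (Localization.AtPrime
        (Ideal.comap (Subring.inclusion h₀) (maximalIdeal O))) :=
  ttl_perfectDescent_of_pred p (fun _ _ _ _ _ _ _ => True)
    (fun _ _ _ _ _ _ _ _ _ _ _ _ _ _ _ _ _ _ _ _ _ _ => trivial)
    (fun k K _ _ _ _ _ hfg O hk _ R hRfg hRO => hLU k K hfg O hk R hRfg hRO)
    k K hfg O hO trivial R hRfg hRO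

end Summit.ResolutionOfSingularities.ResolutionOfSingularities.Theorems

end
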